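import Summits.KontsevichZagierPeriods.KontsevichZagierPeriods.Theses.CyclesAsDomains
import Summits.KontsevichZagierPeriods.KontsevichZagierPeriods.Theses.Neg

/-!
# Crux `TriplicationAccessible` (stmt-KontsevichZagierPeriods-0312) — line `aoki-shioda-cm-lift` (skeleton v3)

Strategist skeleton (planner-cstrat-stmt-KontsevichZagierPeriods-0312-s2-0, 2026-08-17). Card:
`Lines/aoki_shioda_cm_lift.md`; numerics + exact linear algebra: `Lines/aoki_shioda_cm_lift_numerics.md`;
sorry-free algebraic cores (S1's pointwise Jacobian identity + `HasDerivAt`, the glue constants):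
`Lines/aoki_shioda_cm_lift_algebra.lean`.

MECHANISM. The Aoki–Shioda curve `{X³+Y³+Z³ = 0, W³ = -3^{1/3}XYZ}` on the Fermat surface `X₉²`
(AokiShioda1983 Thm 2) pulls back along the Shioda–Katsura map `F₉ × F₉ ⇢ X₉²` to the explicit
correspondence `D ⊂ F₉ × F₉`: `x₂³ = x₁³ + y₁³`, `y₂³ = -3^{1/3}x₁y₁x₂` — the lift to `F₉` of complex
multiplication by `√-3` on the Fermat cubic = the explicit divisor of the Koblitz–Rohrlich exceptional
isogeny `L_{1,1,7} ~ L_{5,3,1}` of `J(F₉)`. Its real branch is ONE semialgebraic bijection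
`Ψ(u) = (1-(1-u)^{1/3})³/u` of `(0,1)`; pulling back the eigenform `η_{1,6,2}` gives stub S1 (one rule-(2)
+ one rule-(1b) move): `B(1/9,2/3) = 3^{-1/3}(B(2/9,5/9) + B(2/9,2/9))`. EXACT linear algebra over
`ℚ(3^{1/3})` shows that modulo every product-type certified move the crux pair has a ONE-dimensional
obstruction, killed by one `S₃`-rotation relation; the rotation `R3: B(1/9,2/9) = (√3/(2sin(2π/9)))B(1/9,2/3)`
is Green's theorem for the closed real 1-form `Im(z(1+z⁹)^{-1/3}dz)` on the plane sector `0<arg z<2π/9`,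
here CUT INTO ITS TWO SLOPE-BOXES, one Green identity each (stubs G1, G2 — validated numerically box by
box, faces at `0`/`∞` vanish identically, closedness checked, Mathlib branch convention recorded):
`G1 (lower box): sin(2π/9)B(2/9,2/3) = sin(π/9)B(1/9,2/3)`,
`G2 (upper box): sin(4π/9)B(2/9,1/9) = sin(2π/9)B(2/9,2/3) + sin(4π/9)B(1/9,2/3)`, whence R3 with
`λ₃ = (sin(π/9)+sin(4π/9))/sin(4π/9) = √3/(2sin(2π/9))`. The glue (stub S3) is Beta book-keeping with
landed tools only; NO BetaCancellation / PiCancellation (0540).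

References: N. Aoki, T. Shioda (1983) Thm 2; N. Koblitz, D. Rohrlich (1978) Thm 3; G. Andrews, R. Askey,
R. Roy, Special Functions (1999) Thm 1.8.1; M. Kontsevich, D. Zagier, Periods (2001) §1.2.
-/

namespace Summit.KontsevichZagierPeriods.KontsevichZagierPeriods.Cruxes.TriplicationAccessible.AokiShiodaCmLift

/-- **Stub S1 — Aoki–Shioda relator in the `(1,6,2)` eigen-class** (`AS16`): the `B(1/9,2/3)` kernel on
`(0,1)` is KZ-equivalent to `3^{-1/3}` times the SUM of the `B(2/9,5/9)` and `B(2/9,2/9)` kernels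
(value `9.69685618798…` both sides). ONE change of variables `x = Ψ(u) = (1-(1-u)^{1/3})³/u`
(`= (1-c)²/(1+c+c²)`, `c = (1-u)^{1/3}`; `Ψ' = (1-c²)/(c²(1+c+c²)²) > 0`, `Ψ((0,1)) = (0,1)`) whose Jacobian
identity `Ψ^{-8/9}(1-Ψ)^{-1/3}Ψ' = 3^{-1/3}u^{-7/9}[(1-u)^{-4/9}+(1-u)^{-7/9}]` is PROVED pointwise in
`Lines/aoki_shioda_cm_lift_algebra.lean` (`psi_jacobian_u`, `hasDerivAt_psi`, `psi_deriv_pos`,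
`psi_mem_Ioo`); remaining work = the `changeOfVariablesRel` witness (playbook #1), surjectivity onto
`(0,1)`, integrability transport. [AokiShioda1983 Thm 2; KoblitzRohrlich1978 Thm 3; KZ2001 §1.2 (2)] -/
theorem stub_aokiShiodaSixteen :
    ∀ (r r' : Literature.NumberTheory.Transcendental.KZ.IntegralRep 1), r.domain = {x | x 0 ∈ Set.Ioo (0:ℝ) 1} → Set.EqOn r.integrand (fun x => (x 0) ^ (-(8:ℝ)/9) * (1 - x 0) ^ (-(1:ℝ)/3)) r.domain → r'.domain = {x | x 0 ∈ Set.Ioo (0:ℝ) 1} → Set.EqOn r'.integrand (fun x => (3:ℝ) ^ (-(1:ℝ)/3) * ((x 0) ^ (-(7:ℝ)/9) * (1 - x 0) ^ (-(4:ℝ)/9) + (x 0) ^ (-(7:ℝ)/9) * (1 - x 0) ^ (-(7:ℝ)/9))) r'.domain → Literature.NumberTheory.Transcendental.KZ.Equivalent r r' := by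
  sorry

/-- **Stub G1 — Green on the LOWER slope-box** (`S₃`-rotation `(2,6,1) → (1,6,2)`):
`sin(2π/9)·B(2/9,2/3) = sin(π/9)·B(1/9,2/3)` (`= 3.3165201432…`) as a KZ-equivalence of scaled Beta kernels.
Plan: `F(z) = z(1+z⁹)^{-1/3}` (Mathlib `Complex.cpow`, principal branch), `β = Im(F dz)` is a closed
`ℚ`-semialgebraic real 1-form on the box `B₁ = {z = a(1+im) : 0 < a, 0 < m < tan(π/9)}` (holomorphy:
`1+z⁹ ∉ (-∞,0]` there), chart `(a', m)`, `a = a'/(1-a')`, `β = g da' + h dm`,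
`g = Im(F(z)(1+im))/(1-a')²`, `h = Im(F(z)·ia)`. Faces: `m = 0` (real axis) `g ≡ 0`; `a' = 0`: `h = 0`;
`a' = 1` (`z = ∞`, `F = O(|z|⁻²)`): `h = 0`. Top edge `m = tan(π/9)` = the ray `arg z = π/9`,
`z = ρe^{iπ/9}`: for `ρ < 1`, `Im(F dz) = sin(2π/9)ρ(1-ρ⁹)^{-1/3}dρ`; for `ρ > 1` the edge IS the slit and
Mathlib's principal value (`arg(1+z⁹) = π`) is the limit from inside `B₁`:
`Im(F dz) = -sin(π/9)ρ(ρ⁹-1)^{-1/3}dρ`; the corner `ρ = 1` (`a₀' = cos(π/9)/(1+cos(π/9))`) is an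
integrable singularity `|a'-a₀'|^{-1/3}` and its fibre is a null set. KZ chain: two Newton–Leibniz moves
(along `m` over the open base `(0,1)∖{a₀'}` with primitive `g`; along `a'` over `(0,tan(π/9))` with primitive
`h`, both face values `0`), closedness `∂_m g = ∂_{a'}h` on the open box, integrand/domain additivity:
`[(0,a₀'), g(·,tan(π/9))] + [(a₀',1), g(·,tan(π/9))] ~ 0`; then rule (2) along the ray (`ρ = a/cos(π/9)`,
`a = a'/(1-a')`) and `ρ⁹ = x`, resp. `ρ⁻⁹ = 1 - x`… i.e. `∫₀¹ρ(1-ρ⁹)^{-1/3}dρ = (1/9)B(2/9,2/3)`,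
`∫₁^∞ρ(ρ⁹-1)^{-1/3}dρ = (1/9)B(1/9,2/3)`. Numerically validated (strategist `num/green_check.py`).
[KZ2001 §1.2 rules (2),(3)] -/
theorem stub_sectorGreenLowerBox :
    ∀ (r r' : Literature.NumberTheory.Transcendental.KZ.IntegralRep 1), r.domain = {x | x 0 ∈ Set.Ioo (0:ℝ) 1} → Set.EqOn r.integrand (fun x => Real.sin (2 * Real.pi / 9) * ((x 0) ^ (-(7:ℝ)/9) * (1 - x 0) ^ (-(1:ℝ)/3))) r.domain → r'.domain = {x | x 0 ∈ Set.Ioo (0:ℝ) 1} → Set.EqOn r'.integrand (fun x => Real.sin (Real.pi / 9) * ((x 0) ^ (-(8:ℝ)/9) * (1 - x 0) ^ (-(1:ℝ)/3))) r'.domain → Literature.NumberTheory.Transcendental.KZ.Equivalent r r' := by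
  sorry

/-- **Stub G2 (HARDEST) — Green on the UPPER slope-box**:
`sin(4π/9)·B(2/9,1/9) = sin(2π/9)·B(2/9,2/3) + sin(4π/9)·B(1/9,2/3)` (`= 12.8660592970…`) as a
KZ-equivalence `[scaled B(2/9,1/9) kernel] ~ [sum of the two scaled kernels]`. Same form `β = Im(F dz)` on
`B₂ = {tan(π/9) < m < tan(2π/9)}`, same chart and faces (`a' = 0, 1` give `h = 0`). Top edge = ray
`arg z = 2π/9`, `z = ue^{2πi/9}`: `1 + z⁹ = 1 + u⁹ > 0`, `Im(F dz) = sin(4π/9)u(1+u⁹)^{-1/3}du` and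
`∫₀^∞u(1+u⁹)^{-1/3}du = (1/9)B(2/9,1/9)` (`u⁹ = x/(1-x)`). Bottom edge = ray `arg z = π/9` approached from
ABOVE: for `ρ < 1` as in G1 (`sin(2π/9)ρ(1-ρ⁹)^{-1/3}`); for `ρ > 1` the one-sided limit from inside `B₂` is
NOT the principal value: `(1+z⁹)^{-1/3} → |1-ρ⁹|^{-1/3}e^{+iπ/3}`, `Im(F₊dz) = sin(5π/9)ρ(ρ⁹-1)^{-1/3}dρ
= sin(4π/9)ρ(ρ⁹-1)^{-1/3}dρ` — so the primitive `g` of the NL move along `m` must be DEFINED on the closed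
band by this limit on the edge (piecewise, still `ℚ`-semialgebraic: real/imaginary parts of an algebraic
function, `isSemialgebraicFunOn_re_im_*` of KZDilationArgHalving; continuity on each closed fibre
`m ∈ [tan(π/9), tan(2π/9)]` for `a' ≠ a₀'`). KZ chain as in G1: `[(0,1), g(·,tan(2π/9))] ~
[(0,1), g₊(·,tan(π/9))]`, then rule (2) along the rays and `u⁹ = x/(1-x)`, `ρ⁹ = x`, `ρ⁻⁹ = 1-x`.
`|∇F| ~ |z-e^{iπ/9}|^{-4/3}` is integrable on the box; `F = O(|z|⁻²)`. Numerically validated box by box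
(`num/green_check.py`: closedness to 1e-9, faces 0, `top = inner + slit_up`). [KZ2001 §1.2 rules (2),(3)] -/
theorem stub_sectorGreenUpperBox :
    ∀ (r r' : Literature.NumberTheory.Transcendental.KZ.IntegralRep 1), r.domain = {x | x 0 ∈ Set.Ioo (0:ℝ) 1} → Set.EqOn r.integrand (fun x => Real.sin (4 * Real.pi / 9) * ((x 0) ^ (-(7:ℝ)/9) * (1 - x 0) ^ (-(8:ℝ)/9))) r.domain → r'.domain = {x | x 0 ∈ Set.Ioo (0:ℝ) 1} → Set.EqOn r'.integrand (fun x => Real.sin (2 * Real.pi / 9) * ((x 0) ^ (-(7:ℝ)/9) * (1 - x 0) ^ (-(1:ℝ)/3)) + Real.sin (4 * Real.pi / 9) * ((x 0) ^ (-(8:ℝ)/9) * (1 - x 0) ^ (-(1:ℝ)/3))) r'.domain → Literature.NumberTheory.Transcendental.KZ.Equivalent r r' := by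
  sorry

/-- **Stub S3 — the Beta book-keeping** (pattern of `FermatIsogeny.triplicationGlue_proof` /
`TerasomaMultiplication.triplicationFromMultiplication_proof`, landed). (0) R3 from G1, G2:
`[sin(4π/9)k_{1,2}] ~ [sin(2π/9)k_{2,6} + sin(4π/9)k_{1,6}] ~ [(sin(π/9)+sin(4π/9))k_{1,6}]` (G1 on the first
summand, integrand additivity), `λ₃ := (sin(π/9)+sin(4π/9))/sin(4π/9) = √3/(2sin(2π/9))`. Then, in ninths
notation `β(i,j) = [(0,1), x^{i/9-1}(1-x)^{j/9-1}]` (all values checked to 1e-14):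
`L = β(1,4)⊗β(5,7) ~ β(4,7)⊗β(1,11) = (2/3)β(1,2)⊗β(4,7)` (Dirichlet `B(a,b)B(a+b,c) = B(b,c)B(a,b+c)` at
`(1,4,7)/9`: `KZ.dirichletPolar_equivalent` + `KZ.dirichletLinear_equivalent`; translation
`KZ.betaTranslation_equivalent`) `~ (2/3)λ₃β(1,6)⊗β(4,7)` (R3 ⊗ the fixed rep: `KZ.mul_mem_relations_left_holds`,
`IntegralRep.prod`, reindex, algebraic scalars) `~ (2/3)λ₃3^{-1/3}[β(2,5)+β(2,2)]⊗β(4,7)` (S1 ⊗ β(4,7))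
`~ (2/3)λ₃3^{-1/3}(9/2)([β(4,5)] + [β(2,7)])` (Dirichlet at `(2,5,4)/9`, `(2,2,7)/9`; unit letter `B(2/9,1) = 9/2`
= one NL move with primitive `(9/2)x^{2/9}`) `~ 3^{2/3}λ₃π(1/sin(4π/9) + 1/sin(2π/9))·[unit disc]` (Euler
reflection at `4/9`, `2/9`: `BetaCancellationLine.stub_eulerReflection`, a tree theorem)
`= [unit disc, 2·3^{7/6}]` (`glue_constant`, `rpow_constant` of the algebra file) `~ [disc r = 2, 3^{7/6}/2]`
(rule 2, `z ↦ 2z`; cf. `equivalent_constDisc_radiusTwo`, Cruxes/GammaHodgeSector/Disproof.lean §7).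
[AndrewsAskeyRoy1999 Thm 1.8.1; KZ2001 §1.2] -/
theorem stub_linearNinthGlue :
    (∀ (r r' : Literature.NumberTheory.Transcendental.KZ.IntegralRep 1), r.domain = {x | x 0 ∈ Set.Ioo (0:ℝ) 1} → Set.EqOn r.integrand (fun x => (x 0) ^ (-(8:ℝ)/9) * (1 - x 0) ^ (-(1:ℝ)/3)) r.domain → r'.domain = {x | x 0 ∈ Set.Ioo (0:ℝ) 1} → Set.EqOn r'.integrand (fun x => (3:ℝ) ^ (-(1:ℝ)/3) * ((x 0) ^ (-(7:ℝ)/9) * (1 - x 0) ^ (-(4:ℝ)/9) + (x 0) ^ (-(7:ℝ)/9) * (1 - x 0) ^ (-(7:ℝ)/9))) r'.domain → Literature.NumberTheory.Transcendental.KZ.Equivalent r r') → (∀ (r r' : Literature.NumberTheory.Transcendental.KZ.IntegralRep 1), r.domain = {x | x 0 ∈ Set.Ioo (0:ℝ) 1} → Set.EqOn r.integrand (fun x => Real.sin (2 * Real.pi / 9) * ((x 0) ^ (-(7:ℝ)/9) * (1 - x 0) ^ (-(1:ℝ)/3))) r.domain → r'.domain = {x | x 0 ∈ Set.Ioo (0:ℝ)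 1} → Set.EqOn r'.integrand (fun x => Real.sin (Real.pi / 9) * ((x 0) ^ (-(8:ℝ)/9) * (1 - x 0) ^ (-(1:ℝ)/3))) r'.domain → Literature.NumberTheory.Transcendental.KZ.Equivalent r r') → (∀ (r r' : Literature.NumberTheory.Transcendental.KZ.IntegralRep 1), r.domain = {x | x 0 ∈ Set.Ioo (0:ℝ) 1} → Set.EqOn r.integrand (fun x => Real.sin (4 * Real.pi / 9) * ((x 0) ^ (-(7:ℝ)/9) * (1 - x 0) ^ (-(8:ℝ)/9))) r.domain → r'.domain = {x | x 0 ∈ Set.Ioo (0:ℝ) 1} → Set.EqOn r'.integrand (fun x => Real.sin (2 * Real.pi / 9) * ((x 0) ^ (-(7:ℝ)/9) * (1 - x 0) ^ (-(1:ℝ)/3)) + Real.sin (4 * Real.pi / 9) * ((x 0) ^ (-(8:ℝ)/9) * (1 - x 0) ^ (-(1:ℝ)/3))) r'.domain → Literature.NumberTheory.Transcendental.KZ.Equivalent r r') → Summit.KontsevichZagierPeriods.KontsevichZagierPeriods.Theses.CyclesAsDomains.TriplicationAccessible := by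
  sorry

/-- **Composition**: the four registered stubs conclude the crux BY NAME (CyclesAsDomains copy). -/
theorem TriplicationAccessible_of :
    (∀ (r r' : Literature.NumberTheory.Transcendental.KZ.IntegralRep 1), r.domain = {x | x 0 ∈ Set.Ioo (0:ℝ) 1} → Set.EqOn r.integrand (fun x => (x 0) ^ (-(8:ℝ)/9) * (1 - x 0) ^ (-(1:ℝ)/3)) r.domain → r'.domain = {x | x 0 ∈ Set.Ioo (0:ℝ) 1} → Set.EqOn r'.integrand (fun x => (3:ℝ) ^ (-(1:ℝ)/3) * ((x 0) ^ (-(7:ℝ)/9) * (1 - x 0) ^ (-(4:ℝ)/9) + (x 0) ^ (-(7:ℝ)/9) * (1 - x 0) ^ (-(7:ℝ)/9))) r'.domain → Literature.NumberTheory.Transcendental.KZ.Equivalent r r') →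
    (∀ (r r' : Literature.NumberTheory.Transcendental.KZ.IntegralRep 1), r.domain = {x | x 0 ∈ Set.Ioo (0:ℝ) 1} → Set.EqOn r.integrand (fun x => Real.sin (2 * Real.pi / 9) * ((x 0) ^ (-(7:ℝ)/9) * (1 - x 0) ^ (-(1:ℝ)/3))) r.domain → r'.domain = {x | x 0 ∈ Set.Ioo (0:ℝ) 1} → Set.EqOn r'.integrand (fun x => Real.sin (Real.pi / 9) * ((x 0) ^ (-(8:ℝ)/9) * (1 - x 0) ^ (-(1:ℝ)/3))) r'.domain → Literature.NumberTheory.Transcendental.KZ.Equivalent r r') →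
    (∀ (r r' : Literature.NumberTheory.Transcendental.KZ.IntegralRep 1), r.domain = {x | x 0 ∈ Set.Ioo (0:ℝ) 1} → Set.EqOn r.integrand (fun x => Real.sin (4 * Real.pi / 9) * ((x 0) ^ (-(7:ℝ)/9) * (1 - x 0) ^ (-(8:ℝ)/9))) r.domain → r'.domain = {x | x 0 ∈ Set.Ioo (0:ℝ) 1} → Set.EqOn r'.integrand (fun x => Real.sin (2 * Real.pi / 9) * ((x 0) ^ (-(7:ℝ)/9) * (1 - x 0) ^ (-(1:ℝ)/3)) + Real.sin (4 * Real.pi / 9) * ((x 0) ^ (-(8:ℝ)/9) * (1 - x 0) ^ (-(1:ℝ)/3))) r'.domain → Literature.NumberTheory.Transcendental.KZ.Equivalent r r') →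
    ((∀ (r r' : Literature.NumberTheory.Transcendental.KZ.IntegralRep 1), r.domain = {x | x 0 ∈ Set.Ioo (0:ℝ) 1} → Set.EqOn r.integrand (fun x => (x 0) ^ (-(8:ℝ)/9) * (1 - x 0) ^ (-(1:ℝ)/3)) r.domain → r'.domain = {x | x 0 ∈ Set.Ioo (0:ℝ) 1} → Set.EqOn r'.integrand (fun x => (3:ℝ) ^ (-(1:ℝ)/3) * ((x 0) ^ (-(7:ℝ)/9) * (1 - x 0) ^ (-(4:ℝ)/9) + (x 0) ^ (-(7:ℝ)/9) * (1 - x 0) ^ (-(7:ℝ)/9))) r'.domain → Literature.NumberTheory.Transcendental.KZ.Equivalent r r') → (∀ (r r' : Literature.NumberTheory.Transcendental.KZ.IntegralRep 1), r.domain = {x | x 0 ∈ Set.Ioo (0:ℝ) 1} → Set.EqOn r.integrand (fun x => Real.sin (2 * Real.pi / 9) * ((x 0) ^ (-(7:ℝ)/9) * (1 - x 0) ^ (-(1:ℝ)/3))) r.domain → r'.domain = {x | x 0 ∈ Set.Ioo (0:ℝ) 1} → Set.EqOn r'.integrand (fun x => Real.sin (Real.pi / 9) * ((x 0) ^ (-(8:ℝ)/9)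 * (1 - x 0) ^ (-(1:ℝ)/3))) r'.domain → Literature.NumberTheory.Transcendental.KZ.Equivalent r r') → (∀ (r r' : Literature.NumberTheory.Transcendental.KZ.IntegralRep 1), r.domain = {x | x 0 ∈ Set.Ioo (0:ℝ) 1} → Set.EqOn r.integrand (fun x => Real.sin (4 * Real.pi / 9) * ((x 0) ^ (-(7:ℝ)/9) * (1 - x 0) ^ (-(8:ℝ)/9))) r.domain → r'.domain = {x | x 0 ∈ Set.Ioo (0:ℝ) 1} → Set.EqOn r'.integrand (fun x => Real.sin (2 * Real.pi / 9) * ((x 0) ^ (-(7:ℝ)/9) * (1 - x 0) ^ (-(1:ℝ)/3)) + Real.sin (4 * Real.pi / 9) * ((x 0) ^ (-(8:ℝ)/9) * (1 - x 0) ^ (-(1:ℝ)/3))) r'.domain → Literature.NumberTheory.Transcendental.KZ.Equivalent r r') → Summit.KontsevichZagierPeriods.KontsevichZagierPeriods.Theses.CyclesAsDomains.TriplicationAccessible) →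
    Summit.KontsevichZagierPeriods.KontsevichZagierPeriods.Theses.CyclesAsDomains.TriplicationAccessible :=
  fun h₁ h₂ h₃ h₄ => h₄ h₁ h₂ h₃

/-- **The crux, from the registered stubs** (skeleton form expected by `ledger skeleton check`): the Neg
copy of the shared decl (item stmt-KontsevichZagierPeriods-0312's primary key). -/
theorem TriplicationAccessible_proof :
    Summit.KontsevichZagierPeriods.KontsevichZagierPeriods.Theses.Neg.TriplicationAccessible :=
  fun r r' h₁ h₂ h₃ h₄ =>
    TriplicationAccessible_of stub_aokiShiodaSixteen stub_sectorGreenLowerBox stub_sectorGreenUpperBox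
      stub_linearNinthGlue r r' h₁ h₂ h₃ h₄

/-- The CyclesAsDomains copy (this strategist's route), same term. -/
theorem TriplicationAccessible_proof_cyclesAsDomains :
    Summit.KontsevichZagierPeriods.KontsevichZagierPeriods.Theses.CyclesAsDomains.TriplicationAccessible :=
  TriplicationAccessible_of stub_aokiShiodaSixteen stub_sectorGreenLowerBox stub_sectorGreenUpperBox
    stub_linearNinthGlue

end Summit.KontsevichZagierPeriods.KontsevichZagierPeriods.Cruxes.TriplicationAccessible.AokiShiodaCmLift
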